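import Summits.CriticalPhenomena.SAWScalingLimit.Theorems.SAWMassiveIsingTiltLatticeUniversalityNoTightness
import HarnessLib

/-!
# Crux `LatticeUniversality` (stmt-CriticalPhenomena-0807), line `registered` (birth v4) — what the kernel K2∀ IS
# once SAWTrackTransport's robust `π/3` limit is granted: vertex-convention robustness (VCR), and conversely

Line lead c4 (prover-line-stmt-CriticalPhenomena-0807-c4-0, 2026-08-17), worker W1; `--supports stmt-CriticalPhenomena-0807`.

(HexVL)(P) := for every Dobrushin domain `D` and every hexagonal endpoint approximation `(a, b)` of `D`, the critical
hexagonal chordal law of `D` between `a δ, b δ` (VERTEX convention, `hexSAWLaw`), pushed along the quarter turn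
`σ z = i z`, converges in law to `P (σD)`.

* landed (`tendstoLaw_hexLaw_of_allForm_robustThird`, `…NoTightness.lean`): K2∀ → RL(π/3) P → (HexVL)(P);
* THIS file (`allForm_of_vcr_robustThird`): P chordal → RL(π/3) P → (HexVL)(P) → K2∀.

Hence, granted a chordal robust `π/3` limit `P` (stubs 2–3 of skeleton v4: conjunct (ii) of stmt-16995 and stmt-16963),
the research kernel K2∀ of this line is EQUIVALENT to (HexVL)(P): "the plain hexagonal SAW in the vertex convention has
the same robust limit as the Glazman–Manolescu face walk" — the (A)-free analogue of c3's `allForm_iff_faceNestedSLE`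
(p154406). Proof of the converse: fix the data of K2∀ and a bounded `1`-Lipschitz `f`; with `g = f ∘ σ⁻¹`
(`1`-Lipschitz, `g (σ c) = f c`): the VERTEX side `∫ f∘curve dP^{Hex}_δ(D; a, b) = ∫ g (σ∘curve) dP^{Hex}_δ(D) →
∫ g dP(σD)` by (HexVL); the FACE side `∫ f∘curve dP^{Hex}_δ(faceDomain; p, q) = ∫ g (σ∘curve) d(…)` is within `δ/2`
of `∫ g (S_δ∘curve) d(…)` (`abs_integral_shift_sub_le`), within `2δ` of `∫ g (curve) dQ^{π/3}_δ(S_δ D; a', b')` (exact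
dictionary `stub_gmHexDictionary` + `abs_integral_sub_integral_le_of_dist_le`), which `→ ∫ g dP(σD)` by `RL(π/3)` at
`u δ = −iδ/2` (`eventually_norm_halfShift_le`); subtract.
-/

noncomputable section

namespace Summit.CriticalPhenomena.SAWScalingLimit.Cruxes.LatticeUniversality.Birth

open MeasureTheory Filter Topology Set
open scoped NNReal ENNReal BoundedContinuousFunction
open Complex (I I_ne_zero)
open Literature.Probability.RandomPlanarGeometry
open Literature.Probability.RandomPlanarGeometry.SAW
open Literature.Probability.RandomPlanarGeometry.SAW.YangBaxter
open Literature.Probability.LatticeModels (Site HexVertex hexGraph hexCenter)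
open Summit.CriticalPhenomena.SAWScalingLimit.Theses
open Summit.CriticalPhenomena.SAWScalingLimit.Cruxes.HexTransfer.YbRelay (third IsBdryEdge bdryVertex
  faceDomain gmSimilarity stub_gmHexDictionary)

/-- **Registered sub-goal `allForm_of_vcr_robustThird`: P chordal → RL(π/3) P → (HexVL)(P) → K2∀.** Granted a chordal
family `P` that is the robust full limit at `Θ ≡ π/3` of the critical Glazman–Manolescu walk, vertex-convention
robustness (the plain hexagonal laws of `D`, pushed along `σ`, converge to `P (σD)`) implies the kernel K2∀: both sides
of K2∀ then converge to `P (σD)` — the vertex side by (HexVL), the face side by the exact `π/3` dictionary, the free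
`iδ/2` displacement and `RL(π/3)` at `u δ = −iδ/2`. [folklore] -/
theorem allForm_of_vcr_robustThird : ∀ P : ChordalFamily, P.IsChordal → (∀ (D : DobrushinDomain) (u : ℝ → ℂ) (a b : ℝ → MidEdge), (∀ᶠ δ in 𝓝[>] (0 : ℝ), ‖u δ‖ ≤ δ) → (∀ᶠ δ in 𝓝[>] (0 : ℝ), Nonempty (YangBaxterSAW (fun (_ : ℤ) => Real.pi / 3) ((D.map (similarity 1 one_ne_zero (u δ))).carrier) δ (a δ) (b δ))) → Tendsto (fun δ : ℝ => (δ : ℂ) * planeMidpoint (fun (_ : ℤ) => Real.pi / 3) (a δ)) (𝓝[>] (0 : ℝ)) (𝓝 (D.pt 0)) → Tendsto (fun δ : ℝ => (δ : ℂ) * planeMidpoint (fun (_ : ℤ) => Real.pi / 3) (b δ)) (𝓝[>] (0 : ℝ)) (𝓝 (D.pt 1)) → TendstoLaw (fun δ (γ : YangBaxterSAW (fun (_ : ℤ) => Real.pi / 3) ((D.map (similarity 1 one_ne_zero (u δ))).carrier) δ (a δ) (b δ)) => γ.curve (fun (_ : ℤ) => Real.pi / 3) δ) (fun δ => ybLaw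 (fun (_ : ℤ) => Real.pi / 3) ((D.map (similarity 1 one_ne_zero (u δ))).carrier) δ 1 (a δ) (b δ)) id (P D)) → (∀ (D : DobrushinDomain) (a b : ℝ → HexVertex), SAW.IsEmbEndpointApprox hexGraph hexCenter D a b → TendstoLaw (fun δ (γ : SAW.HexDomainSAW D.carrier δ (a δ) (b δ)) => CurveClass.map (similarity I I_ne_zero 0 : C(ℂ, ℂ)) γ.curve) (fun δ => SAW.hexSAWLaw D.carrier δ (a δ) (b δ)) id (P (D.map (similarity I I_ne_zero 0)))) → ∀ (D : DobrushinDomain) (a b : ℝ → HexVertex), SAW.IsEmbEndpointApprox hexGraph hexCenter D a b → ∀ a' b' : ℝ → MidEdge, (∀ᶠ δ in 𝓝[>] (0 : ℝ), a' δ ≠ b' δ ∧ IsBdryEdge (meshFaces third (((D.map (similarity I I_ne_zero 0)).map (similarity 1 one_ne_zero (-(I * (δ : ℂ) / 2)))).carrier) δ) (a' δ) ∧ IsBdryEdge (meshFaces third (((D.map (similarity I I_ne_zero 0)).map (similarity 1 one_ne_zero (-(I * (δ : ℂ) / 2)))).carrier) δ) (b' δ) ∧ Nonempty (YangBaxterSAW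 third (((D.map (similarity I I_ne_zero 0)).map (similarity 1 one_ne_zero (-(I * (δ : ℂ) / 2)))).carrier) δ (a' δ) (b' δ))) → Tendsto (fun δ : ℝ => (δ : ℂ) * planeMidpoint third (a' δ)) (𝓝[>] (0 : ℝ)) (𝓝 ((D.map (similarity I I_ne_zero 0)).pt 0)) → Tendsto (fun δ : ℝ => (δ : ℂ) * planeMidpoint third (b' δ)) (𝓝[>] (0 : ℝ)) (𝓝 ((D.map (similarity I I_ne_zero 0)).pt 1)) → ∀ f : BoundedContinuousFunction (CurveClass ℂ) ℝ, LipschitzWith 1 f → Tendsto (fun δ : ℝ => (∫ γ, f γ.curve ∂(SAW.hexSAWLaw (faceDomain (((D.map (similarity I I_ne_zero 0)).map (similarity 1 one_ne_zero (-(I * (δ : ℂ) / 2)))).carrier) δ (a' δ)) δ (bdryVertex (meshFaces third (((D.map (similarity I I_ne_zero 0)).map (similarity 1 one_ne_zero (-(I * (δ : ℂ) / 2)))).carrier) δ) (a' δ)) (bdryVertex (meshFaces third (((D.map (similarity I I_ne_zero 0)).map (similarity 1 one_ne_zero (-(I * (δ : ℂ) / 2)))).carrier) δ) (b' δ)))) -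 ∫ γ, f γ.curve ∂(SAW.hexSAWLaw D.carrier δ (a δ) (b δ))) (𝓝[>] (0 : ℝ)) (𝓝 0) := by
  intro P _ hRL3 hV D a b hab a' b' hev ha' hb' f hf
  -- the transported test function `g = f ∘ σ⁻¹`: bounded, `1`-Lipschitz, `g (σ c) = f c`
  have hτL : LipschitzWith 1
      (CurveClass.map (similarity (-I) (neg_ne_zero.2 I_ne_zero) 0 : C(ℂ, ℂ))) := by
    simpa using CurveClass.lipschitzWith_map (lipschitzWith_similarity (-I) (neg_ne_zero.2 I_ne_zero) 0)
  set g : BoundedContinuousFunction (CurveClass ℂ) ℝ := f.compContinuous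
    ⟨CurveClass.map (similarity (-I) (neg_ne_zero.2 I_ne_zero) 0 : C(ℂ, ℂ)), hτL.continuous⟩ with hg_def
  have hg : ∀ c, g (CurveClass.map (similarity I I_ne_zero 0 : C(ℂ, ℂ)) c) = f c := fun c => by
    simp only [hg_def, BoundedContinuousFunction.compContinuous_apply, ContinuousMap.coe_mk, map_negI_map_I]
  have hgL : LipschitzWith 1 g := by
    simpa [hg_def] using hf.comp hτL
  -- (V) the vertex side: `∫ f∘curve dP^{Hex}_δ(D; a, b) = ∫ g (σ∘curve) dP^{Hex}_δ(D; a, b) → ∫ g dP(σD)` by (HexVL)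
  have hVf : Tendsto (fun δ : ℝ => ∫ γ, f γ.curve ∂(SAW.hexSAWLaw D.carrier δ (a δ) (b δ))) (𝓝[>] (0 : ℝ))
      (𝓝 (∫ ω, g (id ω) ∂(P (D.map (similarity I I_ne_zero 0))))) := by
    have h := hV D a b hab g
    simp only [hg] at h
    exact h
  -- (F) the face side. The `π/3` laws of the moving domains `S_δ(D)` between `a' δ, b' δ` converge to `P (σD)`:
  -- robustness `RL(π/3)` at the admissible shift `u δ = −iδ/2`
  have hconv3 := hRL3 (D.map (similarity I I_ne_zero 0)) (fun δ : ℝ => -(I * (δ : ℂ) / 2)) a' b'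
    eventually_norm_halfShift_le (hev.mono fun δ h => h.2.2.2) ha' hb'
  have hY : Tendsto (fun δ : ℝ => ∫ γ, g (γ.curve third δ)
      ∂(ybLaw third (((D.map (similarity I I_ne_zero 0)).map
        (similarity 1 one_ne_zero (-(I * (δ : ℂ) / 2)))).carrier) δ 1 (a' δ) (b' δ))) (𝓝[>] (0 : ℝ))
      (𝓝 (∫ ω, g (id ω) ∂(P (D.map (similarity I I_ne_zero 0))))) := hconv3 g
  -- the face-side hexagonal integral is within `3δ` of that `π/3` integral, eventually
  have hsmall : ∀ᶠ δ : ℝ in 𝓝[>] (0 : ℝ),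
      |(∫ γ, f γ.curve ∂(SAW.hexSAWLaw
            (faceDomain (((D.map (similarity I I_ne_zero 0)).map
              (similarity 1 one_ne_zero (-(I * (δ : ℂ) / 2)))).carrier) δ (a' δ)) δ
            (bdryVertex (meshFaces third (((D.map (similarity I I_ne_zero 0)).map
              (similarity 1 one_ne_zero (-(I * (δ : ℂ) / 2)))).carrier) δ) (a' δ))
            (bdryVertex (meshFaces third (((D.map (similarity I I_ne_zero 0)).map
              (similarity 1 one_ne_zero (-(I * (δ : ℂ) / 2)))).carrier) δ) (b' δ)))) -
        ∫ γ, g (γ.curve third δ)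
            ∂(ybLaw third (((D.map (similarity I I_ne_zero 0)).map
                (similarity 1 one_ne_zero (-(I * (δ : ℂ) / 2)))).carrier) δ 1 (a' δ) (b' δ))| ≤ 3 * δ := by
    filter_upwards [hev, self_mem_nhdsWithin] with δ hδe hδ
    obtain ⟨hne, hba, hbb, hnon⟩ := hδe
    have hδ0 : (0 : ℝ) < δ := hδ
    obtain ⟨φ, hlaw, hdist⟩ := stub_gmHexDictionary _ δ hδ0 (a' δ) (b' δ) hne hba hbb hnon
    -- (A) transport the GM integral along the exact dictionary and pay `2δ`
    have hA : |(∫ γ, g (γ.curve third δ)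
          ∂(ybLaw third (((D.map (similarity I I_ne_zero 0)).map
              (similarity 1 one_ne_zero (-(I * (δ : ℂ) / 2)))).carrier) δ 1 (a' δ) (b' δ))) -
        ∫ γ, g (CurveClass.map (gmSimilarity δ : C(ℂ, ℂ)) γ.curve) ∂(SAW.hexSAWLaw
            (faceDomain (((D.map (similarity I I_ne_zero 0)).map
              (similarity 1 one_ne_zero (-(I * (δ : ℂ) / 2)))).carrier) δ (a' δ)) δ
            (bdryVertex (meshFaces third (((D.map (similarity I I_ne_zero 0)).map
              (similarity 1 one_ne_zero (-(I * (δ : ℂ) / 2)))).carrier) δ) (a' δ))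
            (bdryVertex (meshFaces third (((D.map (similarity I I_ne_zero 0)).map
              (similarity 1 one_ne_zero (-(I * (δ : ℂ) / 2)))).carrier) δ) (b' δ)))| ≤ 2 * δ := by
      rw [hlaw, integral_map (SAW.EmbDomainSAW.measurable_of_top φ).aemeasurable
        (YBWalk.measurable_of_top _).aestronglyMeasurable]
      exact abs_integral_sub_integral_le_of_dist_le _ (hexSAWLaw_univ_le_one _ _ _ _) g hgL
        (by positivity) hdist (SAW.EmbDomainSAW.measurable_of_top _).aestronglyMeasurable
        (SAW.EmbDomainSAW.measurable_of_top _).aestronglyMeasurable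
    -- (B) `S_δ ↦ σ` on the face-domain side costs `δ/2`; and `g ∘ σ ∘ curve = f ∘ curve`
    have hB := abs_integral_shift_sub_le hδ0.le (Ω := faceDomain (((D.map (similarity I I_ne_zero 0)).map
        (similarity 1 one_ne_zero (-(I * (δ : ℂ) / 2)))).carrier) δ (a' δ))
      (a := bdryVertex (meshFaces third (((D.map (similarity I I_ne_zero 0)).map
        (similarity 1 one_ne_zero (-(I * (δ : ℂ) / 2)))).carrier) δ) (a' δ))
      (b := bdryVertex (meshFaces third (((D.map (similarity I I_ne_zero 0)).map
        (similarity 1 one_ne_zero (-(I * (δ : ℂ) / 2)))).carrier) δ) (b' δ)) g hgL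
    simp only [hg] at hB
    rw [abs_le] at hA hB ⊢
    constructor <;> linarith [hA.1, hA.2, hB.1, hB.2]
  have h3δ : Tendsto (fun δ : ℝ => 3 * δ) (𝓝[>] (0 : ℝ)) (𝓝 0) := by
    have h : Tendsto (fun δ : ℝ => 3 * δ) (𝓝 (0 : ℝ)) (𝓝 (3 * 0)) := tendsto_id.const_mul 3
    rw [mul_zero] at h
    exact tendsto_nhdsWithin_of_tendsto_nhds h
  have hdiff := squeeze_zero_norm' (hsmall.mono fun δ h => le_of_eq_of_le (Real.norm_eq_abs _) h) h3δ
  -- so the face side converges to `∫ g dP(σD)` as well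
  have hF := hdiff.add hY
  rw [zero_add] at hF
  -- (end) subtract: both sides of the kernel's bracket have the same limit
  have h := hF.sub hVf
  rw [sub_self] at h
  exact h.congr fun δ => by ring

/-! ### The equivalence (lead c4): under a robust `π/3` limit, K2∀ ↔ vertex-convention robustness (VCR) -/

/-- **Registered sub-goal `vcr_of_allForm`: K2∀ → VCR**, where VCR := "for every CHORDAL family `P` with `RL(π/3) P`,
(HexVL)(P)" — vertex-convention robustness of the Glazman–Manolescu `π/3` robust limit. Immediate from the landed
`tendstoLaw_hexLaw_of_allForm_robustThird` (p156087). VCR is therefore a WEAKER statement than the kernel K2∀, and it is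
all the v4 composition consumes (`latticeUniversality_of_allForm_robustLimits` uses K2∀ only through (HexVL)). [folklore] -/
theorem vcr_of_allForm : (∀ (D : DobrushinDomain) (a b : ℝ → HexVertex), SAW.IsEmbEndpointApprox hexGraph hexCenter D a b → ∀ a' b' : ℝ → MidEdge, (∀ᶠ δ in 𝓝[>] (0 : ℝ), a' δ ≠ b' δ ∧ IsBdryEdge (meshFaces third (((D.map (similarity I I_ne_zero 0)).map (similarity 1 one_ne_zero (-(I * (δ : ℂ) / 2)))).carrier) δ) (a' δ) ∧ IsBdryEdge (meshFaces third (((D.map (similarity I I_ne_zero 0)).map (similarity 1 one_ne_zero (-(I * (δ : ℂ) / 2)))).carrier) δ) (b' δ) ∧ Nonempty (YangBaxterSAW third (((D.map (similarity I I_ne_zero 0)).map (similarity 1 one_ne_zero (-(I * (δ : ℂ) / 2)))).carrier) δ (a' δ) (b' δ))) → Tendsto (fun δ : ℝ => (δ : ℂ) * planeMidpoint third (a' δ)) (𝓝[>] (0 : ℝ)) (𝓝 ((D.map (similarity I I_ne_zero 0)).pt 0)) → Tendsto (fun δ : ℝ => (δ : ℂ) * planeMidpoint third (b' δ)) (𝓝[>]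 (0 : ℝ)) (𝓝 ((D.map (similarity I I_ne_zero 0)).pt 1)) → ∀ f : BoundedContinuousFunction (CurveClass ℂ) ℝ, LipschitzWith 1 f → Tendsto (fun δ : ℝ => (∫ γ, f γ.curve ∂(SAW.hexSAWLaw (faceDomain (((D.map (similarity I I_ne_zero 0)).map (similarity 1 one_ne_zero (-(I * (δ : ℂ) / 2)))).carrier) δ (a' δ)) δ (bdryVertex (meshFaces third (((D.map (similarity I I_ne_zero 0)).map (similarity 1 one_ne_zero (-(I * (δ : ℂ) / 2)))).carrier) δ) (a' δ)) (bdryVertex (meshFaces third (((D.map (similarity I I_ne_zero 0)).map (similarity 1 one_ne_zero (-(I * (δ : ℂ) / 2)))).carrier) δ) (b' δ)))) - ∫ γ, f γ.curve ∂(SAW.hexSAWLaw D.carrier δ (a δ) (b δ))) (𝓝[>] (0 : ℝ)) (𝓝 0)) → ∀ P : ChordalFamily, P.IsChordal → (∀ (D : DobrushinDomain) (u : ℝ → ℂ) (a b : ℝ → MidEdge), (∀ᶠ δ in 𝓝[>] (0 : ℝ), ‖u δ‖ ≤ δ) → (∀ᶠ δ in 𝓝[>] (0 : ℝ), Nonempty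 (YangBaxterSAW (fun (_ : ℤ) => Real.pi / 3) ((D.map (similarity 1 one_ne_zero (u δ))).carrier) δ (a δ) (b δ))) → Tendsto (fun δ : ℝ => (δ : ℂ) * planeMidpoint (fun (_ : ℤ) => Real.pi / 3) (a δ)) (𝓝[>] (0 : ℝ)) (𝓝 (D.pt 0)) → Tendsto (fun δ : ℝ => (δ : ℂ) * planeMidpoint (fun (_ : ℤ) => Real.pi / 3) (b δ)) (𝓝[>] (0 : ℝ)) (𝓝 (D.pt 1)) → TendstoLaw (fun δ (γ : YangBaxterSAW (fun (_ : ℤ) => Real.pi / 3) ((D.map (similarity 1 one_ne_zero (u δ))).carrier) δ (a δ) (b δ)) => γ.curve (fun (_ : ℤ) => Real.pi / 3) δ) (fun δ => ybLaw (fun (_ : ℤ) => Real.pi / 3) ((D.map (similarity 1 one_ne_zero (u δ))).carrier) δ 1 (a δ) (b δ)) id (P D)) → ∀ (D : DobrushinDomain) (a b : ℝ → HexVertex), SAW.IsEmbEndpointApprox hexGraph hexCenter D a b → TendstoLaw (fun δ (γ : SAW.HexDomainSAW D.carrier δ (a δ) (b δ)) => CurveClass.map (similarity I I_ne_zero 0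 : C(ℂ, ℂ)) γ.curve) (fun δ => SAW.hexSAWLaw D.carrier δ (a δ) (b δ)) id (P (D.map (similarity I I_ne_zero 0))) :=
  fun hK P hPch hRL3 => tendstoLaw_hexLaw_of_allForm_robustThird hK P hPch hRL3

/-- **Registered sub-goal `allForm_iff_vcr`: granted SOME chordal robust `π/3` limit (stubs 2–3 of skeleton v4: conjunct
(ii) of stmt-16995 and stmt-16963), K2∀ ↔ VCR.** (`vcr_of_allForm`; conversely apply VCR to the given `P` and
`allForm_of_vcr_robustThird`.) This is the (A)-free analogue of c3's `allForm_iff_faceNestedSLE` (p154406): on this line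
the research kernel may be filed in either form; VCR hands its prover a limit object and translation robustness. [folklore] -/
theorem allForm_iff_vcr : (∃ P : ChordalFamily, P.IsChordal ∧ ∀ (D : DobrushinDomain) (u : ℝ → ℂ) (a b : ℝ → MidEdge), (∀ᶠ δ in 𝓝[>] (0 : ℝ), ‖u δ‖ ≤ δ) → (∀ᶠ δ in 𝓝[>] (0 : ℝ), Nonempty (YangBaxterSAW (fun (_ : ℤ) => Real.pi / 3) ((D.map (similarity 1 one_ne_zero (u δ))).carrier) δ (a δ) (b δ))) → Tendsto (fun δ : ℝ => (δ : ℂ) * planeMidpoint (fun (_ : ℤ) => Real.pi / 3) (a δ)) (𝓝[>] (0 : ℝ)) (𝓝 (D.pt 0)) → Tendsto (fun δ : ℝ => (δ : ℂ) * planeMidpoint (fun (_ : ℤ) => Real.pi / 3) (b δ)) (𝓝[>] (0 : ℝ)) (𝓝 (D.pt 1)) → TendstoLaw (fun δ (γ : YangBaxterSAW (fun (_ : ℤ) => Real.pi / 3) ((D.map (similarity 1 one_ne_zero (u δ))).carrier) δ (a δ) (b δ)) => γ.curve (fun (_ : ℤ) => Real.pi / 3) δ) (fun δ => ybLaw (fun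 (_ : ℤ) => Real.pi / 3) ((D.map (similarity 1 one_ne_zero (u δ))).carrier) δ 1 (a δ) (b δ)) id (P D)) → ((∀ (D : DobrushinDomain) (a b : ℝ → HexVertex), SAW.IsEmbEndpointApprox hexGraph hexCenter D a b → ∀ a' b' : ℝ → MidEdge, (∀ᶠ δ in 𝓝[>] (0 : ℝ), a' δ ≠ b' δ ∧ IsBdryEdge (meshFaces third (((D.map (similarity I I_ne_zero 0)).map (similarity 1 one_ne_zero (-(I * (δ : ℂ) / 2)))).carrier) δ) (a' δ) ∧ IsBdryEdge (meshFaces third (((D.map (similarity I I_ne_zero 0)).map (similarity 1 one_ne_zero (-(I * (δ : ℂ) / 2)))).carrier) δ) (b' δ) ∧ Nonempty (YangBaxterSAW third (((D.map (similarity I I_ne_zero 0)).map (similarity 1 one_ne_zero (-(I * (δ : ℂ) / 2)))).carrier) δ (a' δ) (b' δ))) → Tendsto (fun δ : ℝ => (δ : ℂ) * planeMidpoint third (a' δ)) (𝓝[>] (0 : ℝ)) (𝓝 ((D.map (similarity I I_ne_zero 0)).pt 0)) → Tendsto (fun δ : ℝ => (δ : ℂ) * planeMidpoint third (b' δ)) (𝓝[>]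 (0 : ℝ)) (𝓝 ((D.map (similarity I I_ne_zero 0)).pt 1)) → ∀ f : BoundedContinuousFunction (CurveClass ℂ) ℝ, LipschitzWith 1 f → Tendsto (fun δ : ℝ => (∫ γ, f γ.curve ∂(SAW.hexSAWLaw (faceDomain (((D.map (similarity I I_ne_zero 0)).map (similarity 1 one_ne_zero (-(I * (δ : ℂ) / 2)))).carrier) δ (a' δ)) δ (bdryVertex (meshFaces third (((D.map (similarity I I_ne_zero 0)).map (similarity 1 one_ne_zero (-(I * (δ : ℂ) / 2)))).carrier) δ) (a' δ)) (bdryVertex (meshFaces third (((D.map (similarity I I_ne_zero 0)).map (similarity 1 one_ne_zero (-(I * (δ : ℂ) / 2)))).carrier) δ) (b' δ)))) - ∫ γ, f γ.curve ∂(SAW.hexSAWLaw D.carrier δ (a δ) (b δ))) (𝓝[>] (0 : ℝ)) (𝓝 0)) ↔ (∀ P : ChordalFamily, P.IsChordal → (∀ (D : DobrushinDomain) (u : ℝ → ℂ) (a b : ℝ → MidEdge), (∀ᶠ δ in 𝓝[>] (0 : ℝ), ‖u δ‖ ≤ δ) → (∀ᶠ δ in 𝓝[>] (0 : ℝ), Nonempty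 (YangBaxterSAW (fun (_ : ℤ) => Real.pi / 3) ((D.map (similarity 1 one_ne_zero (u δ))).carrier) δ (a δ) (b δ))) → Tendsto (fun δ : ℝ => (δ : ℂ) * planeMidpoint (fun (_ : ℤ) => Real.pi / 3) (a δ)) (𝓝[>] (0 : ℝ)) (𝓝 (D.pt 0)) → Tendsto (fun δ : ℝ => (δ : ℂ) * planeMidpoint (fun (_ : ℤ) => Real.pi / 3) (b δ)) (𝓝[>] (0 : ℝ)) (𝓝 (D.pt 1)) → TendstoLaw (fun δ (γ : YangBaxterSAW (fun (_ : ℤ) => Real.pi / 3) ((D.map (similarity 1 one_ne_zero (u δ))).carrier) δ (a δ) (b δ)) => γ.curve (fun (_ : ℤ) => Real.pi / 3) δ) (fun δ => ybLaw (fun (_ : ℤ) => Real.pi / 3) ((D.map (similarity 1 one_ne_zero (u δ))).carrier) δ 1 (a δ) (b δ)) id (P D)) → ∀ (D : DobrushinDomain) (a b : ℝ → HexVertex), SAW.IsEmbEndpointApprox hexGraph hexCenter D a b → TendstoLaw (fun δ (γ : SAW.HexDomainSAW D.carrier δ (a δ) (b δ)) => CurveClass.map (similarity I I_ne_zero 0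 : C(ℂ, ℂ)) γ.curve) (fun δ => SAW.hexSAWLaw D.carrier δ (a δ) (b δ)) id (P (D.map (similarity I I_ne_zero 0))))) :=
  fun ⟨P, hPch, hRL3⟩ => ⟨fun hK Q hQch hQ => vcr_of_allForm hK Q hQch hQ,
    fun hV => allForm_of_vcr_robustThird P hPch hRL3 (hV P hPch hRL3)⟩

/-! ### Skeleton v4.1's composition, VCR-typed (lead c4): the crux — and crux 14221 — from VCR and the transport items -/

/-- **VCR-typed core**: a chordal family `P` that is the robust limit of the critical Glazman–Manolescu walk both on the
square tiling (`RL(π/2) P`) and at `Θ ≡ π/3` (`RL(π/3) P`), vertex-convention robustness VCR, and the toll give the crux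
(`latticeUniversality_of_allForm_robustLimits` with (HexVL) supplied by VCR instead of K2∀). [folklore] -/
theorem latticeUniversality_of_vcr_robustLimits
    (hV : ∀ P : ChordalFamily, P.IsChordal → (∀ (D : DobrushinDomain) (u : ℝ → ℂ) (a b : ℝ → MidEdge), (∀ᶠ δ in 𝓝[>] (0 : ℝ), ‖u δ‖ ≤ δ) → (∀ᶠ δ in 𝓝[>] (0 : ℝ), Nonempty (YangBaxterSAW (fun (_ : ℤ) => Real.pi / 3) ((D.map (similarity 1 one_ne_zero (u δ))).carrier) δ (a δ) (b δ))) → Tendsto (fun δ : ℝ => (δ : ℂ) * planeMidpoint (fun (_ : ℤ) => Real.pi / 3) (a δ)) (𝓝[>] (0 : ℝ)) (𝓝 (D.pt 0)) → Tendsto (fun δ : ℝ => (δ : ℂ) * planeMidpoint (fun (_ : ℤ) => Real.pi / 3) (b δ)) (𝓝[>] (0 : ℝ)) (𝓝 (D.pt 1)) → TendstoLaw (fun δ (γ : YangBaxterSAW (fun (_ : ℤ) => Real.pi / 3) ((D.map (similarity 1 one_ne_zero (u δ))).carrier) δ (a δ) (b δ)) => γ.curve (fun (_ : ℤ) => Real.pi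 / 3) δ) (fun δ => ybLaw (fun (_ : ℤ) => Real.pi / 3) ((D.map (similarity 1 one_ne_zero (u δ))).carrier) δ 1 (a δ) (b δ)) id (P D)) → ∀ (D : DobrushinDomain) (a b : ℝ → HexVertex), SAW.IsEmbEndpointApprox hexGraph hexCenter D a b → TendstoLaw (fun δ (γ : SAW.HexDomainSAW D.carrier δ (a δ) (b δ)) => CurveClass.map (similarity I I_ne_zero 0 : C(ℂ, ℂ)) γ.curve) (fun δ => SAW.hexSAWLaw D.carrier δ (a δ) (b δ)) id (P (D.map (similarity I I_ne_zero 0))))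
    (P : ChordalFamily) (hPch : P.IsChordal)
    (hRL2 : ∀ (D : DobrushinDomain) (u : ℝ → ℂ) (a b : ℝ → MidEdge), (∀ᶠ δ in 𝓝[>] (0 : ℝ), ‖u δ‖ ≤ δ) → (∀ᶠ δ in 𝓝[>] (0 : ℝ), Nonempty (YangBaxterSAW (fun (_ : ℤ) => Real.pi / 2) ((D.map (similarity 1 one_ne_zero (u δ))).carrier) δ (a δ) (b δ))) → Tendsto (fun δ : ℝ => (δ : ℂ) * planeMidpoint (fun (_ : ℤ) => Real.pi / 2) (a δ)) (𝓝[>] (0 : ℝ)) (𝓝 (D.pt 0)) → Tendsto (fun δ : ℝ => (δ : ℂ) * planeMidpoint (fun (_ : ℤ) => Real.pi / 2) (b δ)) (𝓝[>] (0 : ℝ)) (𝓝 (D.pt 1)) → TendstoLaw (fun δ (γ : YangBaxterSAW (fun (_ : ℤ) => Real.pi / 2) ((D.map (similarity 1 one_ne_zero (u δ))).carrier) δ (a δ) (b δ)) => γ.curve (fun (_ : ℤ) => Real.pi / 2) δ) (fun δ => ybLaw (fun (_ : ℤ) => Real.pi / 2) ((D.map (similarity 1 one_ne_zero (u δ))).carrier)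 δ 1 (a δ) (b δ)) id (P D))
    (hRL3 : ∀ (D : DobrushinDomain) (u : ℝ → ℂ) (a b : ℝ → MidEdge), (∀ᶠ δ in 𝓝[>] (0 : ℝ), ‖u δ‖ ≤ δ) → (∀ᶠ δ in 𝓝[>] (0 : ℝ), Nonempty (YangBaxterSAW (fun (_ : ℤ) => Real.pi / 3) ((D.map (similarity 1 one_ne_zero (u δ))).carrier) δ (a δ) (b δ))) → Tendsto (fun δ : ℝ => (δ : ℂ) * planeMidpoint (fun (_ : ℤ) => Real.pi / 3) (a δ)) (𝓝[>] (0 : ℝ)) (𝓝 (D.pt 0)) → Tendsto (fun δ : ℝ => (δ : ℂ) * planeMidpoint (fun (_ : ℤ) => Real.pi / 3) (b δ)) (𝓝[>] (0 : ℝ)) (𝓝 (D.pt 1)) → TendstoLaw (fun δ (γ : YangBaxterSAW (fun (_ : ℤ) => Real.pi / 3) ((D.map (similarity 1 one_ne_zero (u δ))).carrier) δ (a δ) (b δ)) => γ.curve (fun (_ : ℤ) => Real.pi / 3) δ) (fun δ => ybLaw (fun (_ : ℤ) => Real.pi / 3) ((D.map (similarity 1 one_ne_zero (u δ))).carrier)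 δ 1 (a δ) (b δ)) id (P D))
    (h3 : SAWTrackTransport.YBtoUniform) : SAWMassiveIsingTilt.LatticeUniversality := by
  intro D a b a' b' hab hab' f
  -- the rotated `δℤ²` approximation of `σD`; the compass approximation of `σD` on the square tiling
  have habσ := Cruxes.HexTransfer.PinTheShear.stub_quarterTurnCovariance.2 D a b hab
  obtain ⟨a₂, b₂, hab₂⟩ :=
    Cruxes.HexTransfer.Sketch.stub_compassEndpoints (D.map (similarity I I_ne_zero 0))
  -- the transported test function `g = f ∘ σ⁻¹`, with `g (σ c) = f c`
  set g : BoundedContinuousFunction (CurveClass ℂ) ℝ := f.compContinuous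
    ⟨CurveClass.map (similarity (-I) (neg_ne_zero.2 I_ne_zero) 0 : C(ℂ, ℂ)),
      (CurveClass.lipschitzWith_map
        (lipschitzWith_similarity (-I) (neg_ne_zero.2 I_ne_zero) 0)).continuous⟩ with hg_def
  have hg : ∀ c, g (CurveClass.map (similarity I I_ne_zero 0 : C(ℂ, ℂ)) c) = f c := fun c => by
    simp only [hg_def, BoundedContinuousFunction.compContinuous_apply, ContinuousMap.coe_mk, map_negI_map_I]
  -- bracket 1: the toll in `σD` on `g`
  have hZ := h3 (D.map (similarity I I_ne_zero 0)) (fun δ => ![-(a δ 1), a δ 0])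
    (fun δ => ![-(b δ 1), b δ 0]) a₂ b₂ habσ hab₂ g
  -- bracket 2: the square-tiling laws of `σD` converge to `P (σD)` (robust limit at `u ≡ 0`)
  have h2 := Cruxes.HexTransfer.YbRelay.tendstoLaw_of_robustLimit (Real.pi / 2) P hRL2
    (D.map (similarity I I_ne_zero 0)) a₂ b₂ hab₂ g
  -- bracket 3: (HexVL) from VCR
  have hX := hV P hPch hRL3 D a' b' hab' g
  -- assemble
  have h := (hZ.add h2).sub hX
  rw [zero_add, sub_self] at h
  refine h.congr fun δ => ?_
  have hq : ∫ γ, g γ.curve ∂(SAW.law (D.map (similarity I I_ne_zero 0)).carrier δ ![-(a δ 1), a δ 0]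
      ![-(b δ 1), b δ 0]) = ∫ γ, g (CurveClass.map (similarity I I_ne_zero 0 : C(ℂ, ℂ)) γ.curve)
        ∂(SAW.law D.carrier δ (a δ) (b δ)) :=
    integral_quarterTurn D.carrier δ (a δ) (b δ) g
  simp only [hg] at hq ⊢
  linarith [hq]

/-- **Registered sub-goal `latticeUniversality_of_vcr_robustSquare`** — THE COMPOSITION OF SKELETON v4.1: VCR → (conjunct (ii) of
`YBLimitExists`, stmt-16995) → `AngleUniversality` (stmt-16963) → `YBtoUniform` (stmt-16966) → `LatticeUniversality`; its four
antecedents are exactly the four registered stubs `stub_hexVertexRobust`, `stub_ybRobustLimit`, `stub_angleUniversality`,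
`stub_ybToUniform`. No tightness, no (A). [folklore] -/
theorem latticeUniversality_of_vcr_robustSquare : (∀ P : ChordalFamily, P.IsChordal → (∀ (D : DobrushinDomain) (u : ℝ → ℂ) (a b : ℝ → MidEdge), (∀ᶠ δ in 𝓝[>] (0 : ℝ), ‖u δ‖ ≤ δ) → (∀ᶠ δ in 𝓝[>] (0 : ℝ), Nonempty (YangBaxterSAW (fun (_ : ℤ) => Real.pi / 3) ((D.map (similarity 1 one_ne_zero (u δ))).carrier) δ (a δ) (b δ))) → Tendsto (fun δ : ℝ => (δ : ℂ) * planeMidpoint (fun (_ : ℤ) => Real.pi / 3) (a δ)) (𝓝[>] (0 : ℝ)) (𝓝 (D.pt 0)) → Tendsto (fun δ : ℝ => (δ : ℂ) * planeMidpoint (fun (_ : ℤ) => Real.pi / 3) (b δ)) (𝓝[>] (0 : ℝ)) (𝓝 (D.pt 1)) → TendstoLaw (fun δ (γ : YangBaxterSAW (fun (_ : ℤ) => Real.pi / 3) ((D.map (similarity 1 one_ne_zero (u δ))).carrier) δ (a δ) (b δ)) => γ.curve (fun (_ : ℤ) => Real.pi / 3) δ) (fun δ => ybLaw (fun (_ :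 ℤ) => Real.pi / 3) ((D.map (similarity 1 one_ne_zero (u δ))).carrier) δ 1 (a δ) (b δ)) id (P D)) → ∀ (D : DobrushinDomain) (a b : ℝ → HexVertex), SAW.IsEmbEndpointApprox hexGraph hexCenter D a b → TendstoLaw (fun δ (γ : SAW.HexDomainSAW D.carrier δ (a δ) (b δ)) => CurveClass.map (similarity I I_ne_zero 0 : C(ℂ, ℂ)) γ.curve) (fun δ => SAW.hexSAWLaw D.carrier δ (a δ) (b δ)) id (P (D.map (similarity I I_ne_zero 0)))) → (∃ P : ChordalFamily, P.IsChordal ∧ ∀ (D : DobrushinDomain) (u : ℝ → ℂ) (a b : ℝ → MidEdge), (∀ᶠ δ in 𝓝[>] (0 : ℝ), ‖u δ‖ ≤ δ) → (∀ᶠ δ in 𝓝[>] (0 : ℝ), Nonempty (YangBaxterSAW (fun (_ : ℤ) => Real.pi / 2) ((D.map (similarity 1 one_ne_zero (u δ))).carrier) δ (a δ) (b δ))) → Tendsto (fun δ : ℝ => (δ : ℂ) * planeMidpoint (fun (_ : ℤ) => Real.pi / 2) (a δ)) (𝓝[>] (0 : ℝ)) (𝓝 (D.pt 0)) → Tendsto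 (fun δ : ℝ => (δ : ℂ) * planeMidpoint (fun (_ : ℤ) => Real.pi / 2) (b δ)) (𝓝[>] (0 : ℝ)) (𝓝 (D.pt 1)) → TendstoLaw (fun δ (γ : YangBaxterSAW (fun (_ : ℤ) => Real.pi / 2) ((D.map (similarity 1 one_ne_zero (u δ))).carrier) δ (a δ) (b δ)) => γ.curve (fun (_ : ℤ) => Real.pi / 2) δ) (fun δ => ybLaw (fun (_ : ℤ) => Real.pi / 2) ((D.map (similarity 1 one_ne_zero (u δ))).carrier) δ 1 (a δ) (b δ)) id (P D)) → SAWTrackTransport.AngleUniversality → SAWTrackTransport.YBtoUniform → SAWMassiveIsingTilt.LatticeUniversality := by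
  rintro hV ⟨P, hPch, hRL2⟩ hAU h3
  have hmem : Real.pi / 3 ∈ Set.Icc (Real.pi / 3) (2 * Real.pi / 3) := ⟨le_rfl, by linarith [Real.pi_pos]⟩
  exact latticeUniversality_of_vcr_robustLimits hV P hPch hRL2 (hAU (Real.pi / 3) hmem P hPch hRL2) h3

/-- **Registered sub-goal `hexTransfer_of_vcr_trackTransport`** — the sibling crux `HexTransfer` (stmt-CriticalPhenomena-14221, route
`SAWPhaseRetrieval`'s spelling) from the SAME four statements (`hexTransfer_of_latticeUniversality`, p106915): 14221 ⇐ {VCR,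
16995 (ii), 16963, 16966} — for the 14221 lead, replacing c3's K2∀-typed `hexTransfer_of_allForm_trackTransport`. [folklore] -/
theorem hexTransfer_of_vcr_trackTransport : (∀ P : ChordalFamily, P.IsChordal → (∀ (D : DobrushinDomain) (u : ℝ → ℂ) (a b : ℝ → MidEdge), (∀ᶠ δ in 𝓝[>] (0 : ℝ), ‖u δ‖ ≤ δ) → (∀ᶠ δ in 𝓝[>] (0 : ℝ), Nonempty (YangBaxterSAW (fun (_ : ℤ) => Real.pi / 3) ((D.map (similarity 1 one_ne_zero (u δ))).carrier) δ (a δ) (b δ))) → Tendsto (fun δ : ℝ => (δ : ℂ) * planeMidpoint (fun (_ : ℤ) => Real.pi / 3) (a δ)) (𝓝[>] (0 : ℝ)) (𝓝 (D.pt 0)) → Tendsto (fun δ : ℝ => (δ : ℂ) * planeMidpoint (fun (_ : ℤ) => Real.pi / 3) (b δ)) (𝓝[>] (0 : ℝ)) (𝓝 (D.pt 1)) → TendstoLaw (fun δ (γ : YangBaxterSAW (fun (_ : ℤ) => Real.pi / 3) ((D.map (similarity 1 one_ne_zero (u δ))).carrier) δ (a δ) (b δ)) => γ.curve (fun (_ :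 ℤ) => Real.pi / 3) δ) (fun δ => ybLaw (fun (_ : ℤ) => Real.pi / 3) ((D.map (similarity 1 one_ne_zero (u δ))).carrier) δ 1 (a δ) (b δ)) id (P D)) → ∀ (D : DobrushinDomain) (a b : ℝ → HexVertex), SAW.IsEmbEndpointApprox hexGraph hexCenter D a b → TendstoLaw (fun δ (γ : SAW.HexDomainSAW D.carrier δ (a δ) (b δ)) => CurveClass.map (similarity I I_ne_zero 0 : C(ℂ, ℂ)) γ.curve) (fun δ => SAW.hexSAWLaw D.carrier δ (a δ) (b δ)) id (P (D.map (similarity I I_ne_zero 0)))) → (∃ P : ChordalFamily, P.IsChordal ∧ ∀ (D : DobrushinDomain) (u : ℝ → ℂ) (a b : ℝ → MidEdge), (∀ᶠ δ in 𝓝[>] (0 : ℝ), ‖u δ‖ ≤ δ) → (∀ᶠ δ in 𝓝[>] (0 : ℝ), Nonempty (YangBaxterSAW (fun (_ : ℤ) => Real.pi / 2) ((D.map (similarity 1 one_ne_zero (u δ))).carrier) δ (a δ) (b δ))) → Tendsto (fun δ : ℝ => (δ : ℂ) * planeMidpoint (fun (_ : ℤ) => Real.pi / 2) (a δ)) (𝓝[>]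 (0 : ℝ)) (𝓝 (D.pt 0)) → Tendsto (fun δ : ℝ => (δ : ℂ) * planeMidpoint (fun (_ : ℤ) => Real.pi / 2) (b δ)) (𝓝[>] (0 : ℝ)) (𝓝 (D.pt 1)) → TendstoLaw (fun δ (γ : YangBaxterSAW (fun (_ : ℤ) => Real.pi / 2) ((D.map (similarity 1 one_ne_zero (u δ))).carrier) δ (a δ) (b δ)) => γ.curve (fun (_ : ℤ) => Real.pi / 2) δ) (fun δ => ybLaw (fun (_ : ℤ) => Real.pi / 2) ((D.map (similarity 1 one_ne_zero (u δ))).carrier) δ 1 (a δ) (b δ)) id (P D)) → SAWTrackTransport.AngleUniversality → SAWTrackTransport.YBtoUniform → SAWPhaseRetrieval.HexTransfer :=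
  fun hV hL hAU h3 => Cruxes.HexTransfer.Sandwich.hexTransfer_of_latticeUniversality
    (latticeUniversality_of_vcr_robustSquare hV hL hAU h3)

end Summit.CriticalPhenomena.SAWScalingLimit.Cruxes.LatticeUniversality.Birth

end
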